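import Summits.AtomisticToContinuum.Crystallization.Theorems.SquareWellLayerCakeGapTwelveToBarlowFiveFoldRing2

/-!
# Far disjoint five-fold rings are antipodal — part 1/3: angular conversion and planar lemmas

Crux `SquareWellLayerCake.GapTwelveToBarlow` (stmt-AtomisticToContinuum-15807), line `Sketch`,
stub `stub_fiveFoldFarDisjoint` (S2β-FARD): at a Good site `j` with the local `131/100` dichotomy,
two far five-fold bonds `(j,k)`, `(j,k')` with disjoint rings make an angle with `cos ≤ -19/20`.
The hand proof runs on UNIT vectors `(x l - x j)/‖x l - x j‖`; this part supplies

* the thick-shell → angular conversion (`inner_unit_le_of_sep`, `le_inner_unit_of_bonded`,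
  `inner_unit_le_of_far`): radii in `[55/57, 1]` and a chord `≥ 55/57` / `≤ 1` / `≥ 131/100`
  give cosine `≤ 0.5345` / `≥ 0.4629` / `≤ 0.142`;
* a planar frame `exists_planar_frame` about a unit axis `u` (complex numbers `φ p` with
  `Re (φ p · conj (φ q)) = ⟪p, q⟫ - ⟪p, u⟫ ⟪q, u⟫`, the spherical law of cosines);
* two planar lemmas on unit complex numbers: the COVERING lemma `exists_re_ge_of_two_partners`
  (five directions pairwise `≥ arccos γ` apart, each with two partners within `arccos β`, leave
  no gap of half-width `arccos m` when `2m² - 1 < β`, `2γ² - 1 < β`) and the PARTNER-SIDE lemma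
  `re_ge_of_two_far_partners` (numeric instance used in part 2).

Mathlib + the landed ring files (`re_mul_conj`, `re_rot_mul_conj_rot`) only; no named fact is used.
-/

noncomputable section

namespace Summit.AtomisticToContinuum.Crystallization.Theorems.SquareWellLayerCakeGapTwelveToBarlow

open scoped InnerProductSpace ComplexConjugate Real

/-! ## Thick shell to unit vectors -/

/-- Inner product of the normalisations: `⟪p/‖p‖, q/‖q‖⟫ = ⟪p, q⟫ / (‖p‖ ‖q‖)`. [folklore] -/
theorem inner_unit_unit {E : Type*} [NormedAddCommGroup E] [InnerProductSpace ℝ E] (p q : E) :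
    ⟪‖p‖⁻¹ • p, ‖q‖⁻¹ • q⟫_ℝ = ⟪p, q⟫_ℝ / (‖p‖ * ‖q‖) := by
  rw [real_inner_smul_left, real_inner_smul_right, ← mul_assoc, ← mul_inv, div_eq_inv_mul]

/-- **Separated pairs.**  Radii in `[55/57, 1]` and chord `≥ 55/57` give cosine `≤ 0.5345`
(extremal: both radii `1`, `1 - (55/57)²/2 = 0.53447…`). [folklore] -/
theorem inner_unit_le_of_sep {E : Type*} [NormedAddCommGroup E] [InnerProductSpace ℝ E] {p q : E}
    (hp1 : 55 / 57 ≤ ‖p‖) (hp2 : ‖p‖ ≤ 1) (hq1 : 55 / 57 ≤ ‖q‖) (hq2 : ‖q‖ ≤ 1)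
    (hpq : 55 / 57 ≤ ‖p - q‖) : ⟪‖p‖⁻¹ • p, ‖q‖⁻¹ • q⟫_ℝ ≤ 0.5345 := by
  have hp0 : 0 < ‖p‖ := by linarith
  have hq0 : 0 < ‖q‖ := by linarith
  have hD : (55 / 57 : ℝ) ^ 2 ≤ ‖p - q‖ ^ 2 := pow_le_pow_left₀ (by norm_num) hpq 2
  have hn := norm_sub_sq_real p q
  rw [inner_unit_unit, div_le_iff₀ (mul_pos hp0 hq0)]
  nlinarith [mul_nonneg (sub_nonneg.2 hp2) (show (0 : ℝ) ≤ ‖p‖ - 0.069 by linarith),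
    mul_nonneg (sub_nonneg.2 hq2) (show (0 : ℝ) ≤ ‖q‖ - 0.069 by linarith),
    mul_nonneg (sub_nonneg.2 hp2) (sub_nonneg.2 hq2)]

/-- **Bonded pairs.**  Radii `≥ 55/57` and chord `≤ 1` give cosine `≥ 0.4629`
(extremal: both radii `55/57`, `1 - 1/(2 (55/57)²) = 0.46297…`). [folklore] -/
theorem le_inner_unit_of_bonded {E : Type*} [NormedAddCommGroup E] [InnerProductSpace ℝ E]
    {p q : E} (hp1 : 55 / 57 ≤ ‖p‖) (hq1 : 55 / 57 ≤ ‖q‖) (hpq : ‖p - q‖ ≤ 1) :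
    0.4629 ≤ ⟪‖p‖⁻¹ • p, ‖q‖⁻¹ • q⟫_ℝ := by
  have hp0 : 0 < ‖p‖ := by linarith
  have hq0 : 0 < ‖q‖ := by linarith
  have hD : ‖p - q‖ ^ 2 ≤ 1 := pow_le_one₀ (norm_nonneg _) hpq
  have hn := norm_sub_sq_real p q
  rw [inner_unit_unit, le_div_iff₀ (mul_pos hp0 hq0)]
  nlinarith [sq_nonneg (‖p‖ - ‖q‖), mul_le_mul hp1 hq1 (by norm_num) (norm_nonneg p)]

/-- **Far pairs.**  Radii in `[55/57, 1]` and chord `≥ 131/100` give cosine `≤ 0.142`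
(extremal: both radii `1`, `1 - (131/100)²/2 = 0.14195`). [folklore] -/
theorem inner_unit_le_of_far {E : Type*} [NormedAddCommGroup E] [InnerProductSpace ℝ E] {p q : E}
    (hp1 : 55 / 57 ≤ ‖p‖) (hp2 : ‖p‖ ≤ 1) (hq1 : 55 / 57 ≤ ‖q‖) (hq2 : ‖q‖ ≤ 1)
    (hpq : 131 / 100 ≤ ‖p - q‖) : ⟪‖p‖⁻¹ • p, ‖q‖⁻¹ • q⟫_ℝ ≤ 0.142 := by
  have hp0 : 0 < ‖p‖ := by linarith
  have hq0 : 0 < ‖q‖ := by linarith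
  have hD : (131 / 100 : ℝ) ^ 2 ≤ ‖p - q‖ ^ 2 := pow_le_pow_left₀ (by norm_num) hpq 2
  have hn := norm_sub_sq_real p q
  rw [inner_unit_unit, div_le_iff₀ (mul_pos hp0 hq0)]
  nlinarith [mul_nonneg (sub_nonneg.2 hp2) (show (0 : ℝ) ≤ ‖p‖ + 0.716 by linarith),
    mul_nonneg (sub_nonneg.2 hq2) (show (0 : ℝ) ≤ ‖q‖ + 0.716 by linarith),
    mul_nonneg (sub_nonneg.2 hp2) (sub_nonneg.2 hq2)]

/-! ## The planar frame of a unit axis -/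

/-- **Planar frame.**  For a unit vector `u` of `ℝ³` there is a map `φ : ℝ³ → ℂ` (the horizontal
part read in `u^⊥ ≃ ℂ`) with `Re (φ p · conj (φ q)) = ⟪p, q⟫ - ⟪p, u⟫ ⟪q, u⟫` for all `p, q` — the
spherical law of cosines `cos c = cos a cos b + sin a sin b cos C` in coordinates. [folklore] -/
theorem exists_planar_frame (u : EuclideanSpace ℝ (Fin 3)) (hu : ‖u‖ = 1) :
    ∃ φ : EuclideanSpace ℝ (Fin 3) → ℂ, ∀ p q : EuclideanSpace ℝ (Fin 3),
      (φ p * conj (φ q)).re = ⟪p, q⟫_ℝ - ⟪p, u⟫_ℝ * ⟪q, u⟫_ℝ := by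
  have hu0 : u ≠ 0 := fun h => by
    rw [h, norm_zero] at hu
    exact zero_ne_one hu
  have huu : ⟪u, u⟫_ℝ = 1 := by rw [real_inner_self_eq_norm_sq, hu, one_pow]
  haveI : Fact (Module.finrank ℝ (EuclideanSpace ℝ (Fin 3)) = 2 + 1) :=
    ⟨by rw [finrank_euclideanSpace_fin]⟩
  let Φ : (ℝ ∙ u)ᗮ ≃ₗᵢ[ℝ] ℂ :=
    (Complex.isometryOfOrthonormal (OrthonormalBasis.fromOrthogonalSpanSingleton 2 hu0)).symm
  have hmem : ∀ p : EuclideanSpace ℝ (Fin 3), p - ⟪p, u⟫_ℝ • u ∈ (ℝ ∙ u)ᗮ := fun p =>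
    Submodule.mem_orthogonal_singleton_iff_inner_left.mpr
      (by rw [inner_sub_left, real_inner_smul_left, huu, mul_one, sub_self])
  refine ⟨fun p => Φ ⟨p - ⟪p, u⟫_ℝ • u, hmem p⟩, fun p q => ?_⟩
  rw [← Complex.inner, LinearIsometryEquiv.inner_map_map, Submodule.coe_inner, Submodule.coe_mk,
    Submodule.coe_mk, inner_sub_left, inner_sub_right, inner_sub_right, real_inner_smul_left,
    real_inner_smul_left, real_inner_smul_right, real_inner_smul_right, huu, real_inner_comm q p,
    real_inner_comm p u]
  ring

/-- Squared norm in the planar frame: `‖φ p‖² = ‖p‖² - ⟪p, u⟫²`. [folklore] -/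
theorem norm_sq_of_frame {φ : EuclideanSpace ℝ (Fin 3) → ℂ} {u : EuclideanSpace ℝ (Fin 3)}
    (hφ : ∀ p q : EuclideanSpace ℝ (Fin 3),
      (φ p * conj (φ q)).re = ⟪p, q⟫_ℝ - ⟪p, u⟫_ℝ * ⟪q, u⟫_ℝ)
    (p : EuclideanSpace ℝ (Fin 3)) : ‖φ p‖ ^ 2 = ‖p‖ ^ 2 - ⟪p, u⟫_ℝ ^ 2 := by
  have h := hφ p p
  rw [Complex.mul_conj, Complex.ofReal_re, Complex.normSq_eq_norm_sq, real_inner_self_eq_norm_sq]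
    at h
  rw [h]
  ring

/-- Real part after normalising by real scalars:
`Re ((z₁/r₁) conj (z₂/r₂)) · (r₁ r₂) = Re (z₁ conj z₂)` for `r₁, r₂ ≠ 0`. [folklore] -/
theorem re_div_mul_conj_div (z₁ z₂ : ℂ) {r₁ r₂ : ℝ} (h₁ : r₁ ≠ 0) (h₂ : r₂ ≠ 0) :
    (z₁ / (r₁ : ℂ) * conj (z₂ / (r₂ : ℂ))).re * (r₁ * r₂) = (z₁ * conj z₂).re := by
  have h : z₁ / (r₁ : ℂ) * conj (z₂ / (r₂ : ℂ)) = (z₁ * conj z₂) / ((r₁ * r₂ : ℝ) : ℂ) := by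
    rw [map_div₀, Complex.conj_ofReal, div_mul_div_comm, Complex.ofReal_mul]
  rw [h, Complex.div_ofReal_re, div_mul_cancel₀ _ (mul_ne_zero h₁ h₂)]

/-- Norm after normalising by the norm: `‖z / ‖z‖‖ = 1` for `z ≠ 0` (real division). [folklore] -/
theorem norm_div_coe_norm_eq_one {z : ℂ} (hz : ‖z‖ ≠ 0) : ‖z / (‖z‖ : ℂ)‖ = 1 := by
  rw [norm_div, Complex.norm_real, Real.norm_eq_abs, abs_of_nonneg (norm_nonneg _), div_self hz]

/-! ## Planar lemma 1: a two-regular ring covers every direction -/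

/-- **Covering lemma.**  Let `w i` (`i ∈ S`, `S` nonempty) be unit complex numbers, pairwise with
`Re (w i conj (w j)) ≤ γ`, each having two distinct partners `a, b ≠ i` in `S` with
`Re (w i conj (w a)), Re (w i conj (w b)) ≥ β`, where `0 < m < 1`, `2m² - 1 < β`, `2γ² - 1 < β`
(`β, γ ∈ [-1, 1]`).  Then some `w i` has `Re (w i) ≥ m`: otherwise all points avoid the arc
`|arg| ≤ arccos m`; the point of least angle in `(arccos m, 2π - arccos m)` has both partners
within `arccos β` counter-clockwise of it (wrapping round would need an angle `> 2π - 2 arccos m`,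
of cosine `< 2m² - 1 < β`), pairwise and from it at least `arccos γ` apart — impossible as
`arccos β < 2 arccos γ`. [folklore] -/
theorem exists_re_ge_of_two_partners {ι : Type*} (S : Finset ι) (hS : S.Nonempty) (w : ι → ℂ)
    {β γ m : ℝ} (hm0 : 0 < m) (hm1 : m < 1) (hβ1 : -1 ≤ β) (hβ2 : β ≤ 1) (hγ1 : -1 ≤ γ)
    (hγ2 : γ ≤ 1) (hmb : 2 * m ^ 2 - 1 < β) (hgb : 2 * γ ^ 2 - 1 < β)
    (h1 : ∀ i ∈ S, ‖w i‖ = 1)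
    (hsep : ∀ i ∈ S, ∀ j ∈ S, i ≠ j → (w i * conj (w j)).re ≤ γ)
    (hpart : ∀ i ∈ S, ∃ a ∈ S, ∃ b ∈ S, a ≠ i ∧ b ≠ i ∧ a ≠ b ∧
      β ≤ (w i * conj (w a)).re ∧ β ≤ (w i * conj (w b)).re) :
    ∃ i ∈ S, m ≤ (w i).re := by
  classical
  by_contra! H
  have hre : ∀ i ∈ S, Real.cos (Complex.arg (w i)) = (w i).re := fun i hi => by
    have := Complex.norm_mul_cos_arg (w i)
    rwa [h1 i hi, one_mul] at this
  have him : ∀ i ∈ S, Real.sin (Complex.arg (w i)) = (w i).im := fun i hi => by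
    have := Complex.norm_mul_sin_arg (w i)
    rwa [h1 i hi, one_mul] at this
  -- the angle in `[0, 2π)`
  obtain ⟨c, hc⟩ : ∃ c : ι → ℝ, ∀ i, c i =
      if 0 ≤ Complex.arg (w i) then Complex.arg (w i) else Complex.arg (w i) + 2 * π :=
    ⟨_, fun _ => rfl⟩
  have hcos : ∀ i ∈ S, Real.cos (c i) = (w i).re := by
    intro i hi
    rw [hc]
    split_ifs
    · exact hre i hi
    · rw [Real.cos_add_two_pi]
      exact hre i hi
  have hsin : ∀ i ∈ S, Real.sin (c i) = (w i).im := by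
    intro i hi
    rw [hc]
    split_ifs
    · exact him i hi
    · rw [Real.sin_add_two_pi]
      exact him i hi
  have hc0 : ∀ i, 0 ≤ c i := by
    intro i
    rw [hc]
    split_ifs with h
    · exact h
    · linarith [Complex.neg_pi_lt_arg (w i)]
  have hc2 : ∀ i, c i < 2 * π := by
    intro i
    rw [hc]
    split_ifs with h
    · linarith [Complex.arg_le_pi (w i), Real.pi_pos]
    · push Not at h
      linarith
  have hcosd : ∀ i ∈ S, ∀ j ∈ S, Real.cos (c j - c i) = (w i * conj (w j)).re := by
    intro i hi j hj
    rw [Real.cos_sub, hcos i hi, hcos j hj, hsin i hi, hsin j hj, re_mul_conj]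
    ring
  -- every angle lies in `(φ₀, 2π - φ₀)`, `φ₀ = arccos m`
  have hφ₀ : Real.cos (Real.arccos m) = m := Real.cos_arccos (by linarith) hm1.le
  have hφ₀pos : 0 < Real.arccos m := Real.arccos_pos.2 hm1
  have hφ₀lt : Real.arccos m < π / 2 := Real.arccos_lt_pi_div_two.2 hm0
  have hlo : ∀ i ∈ S, Real.arccos m < c i := by
    intro i hi
    by_contra! hle
    have h := Real.cos_le_cos_of_nonneg_of_le_pi (hc0 i) (Real.arccos_le_pi m) hle
    rw [hφ₀, hcos i hi] at h
    linarith [H i hi]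
  have hhi : ∀ i ∈ S, c i < 2 * π - Real.arccos m := by
    intro i hi
    by_contra! hle
    have h := Real.cos_le_cos_of_nonneg_of_le_pi (x := 2 * π - c i) (y := Real.arccos m)
      (by linarith [hc2 i]) (Real.arccos_le_pi m) (by linarith)
    rw [hφ₀, Real.cos_two_pi_sub, hcos i hi] at h
    linarith [H i hi]
  -- the point of least angle and its two partners
  obtain ⟨i₁, hi₁, hmin⟩ := Finset.exists_min_image S c hS
  obtain ⟨a, ha, b, hb, hai, hbi, hab, hβa, hβb⟩ := hpart i₁ hi₁
  have hφ₁ : Real.cos (Real.arccos β) = β := Real.cos_arccos hβ1 hβ2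
  have hφ₂ : Real.cos (Real.arccos γ) = γ := Real.cos_arccos hγ1 hγ2
  have key : ∀ j ∈ S, j ≠ i₁ → β ≤ (w i₁ * conj (w j)).re →
      Real.arccos γ ≤ c j - c i₁ ∧ c j - c i₁ ≤ Real.arccos β := by
    intro j hj hji hβj
    have hx0 : 0 ≤ c j - c i₁ := by linarith [hmin j hj]
    have hcosx : Real.cos (c j - c i₁) = (w i₁ * conj (w j)).re := hcosd i₁ hi₁ j hj
    have hxπ : c j - c i₁ ≤ π := by
      by_contra! hgt
      have h := Real.cos_lt_cos_of_nonneg_of_le_pi (x := 2 * Real.arccos m)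
        (y := 2 * π - (c j - c i₁)) (by linarith) (by linarith) (by linarith [hhi j hj, hlo i₁ hi₁])
      rw [Real.cos_two_pi_sub, Real.cos_two_mul, hφ₀, hcosx] at h
      linarith
    constructor
    · by_contra! hlt
      have h := Real.cos_lt_cos_of_nonneg_of_le_pi hx0 (Real.arccos_le_pi γ) hlt
      rw [hφ₂, hcosx] at h
      linarith [hsep i₁ hi₁ j hj hji.symm]
    · by_contra! hlt
      have h := Real.cos_lt_cos_of_nonneg_of_le_pi (Real.arccos_nonneg β) hxπ hlt
      rw [hφ₁, hcosx] at h
      linarith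
  obtain ⟨ha1, ha2⟩ := key a ha hai hβa
  obtain ⟨hb1, hb2⟩ := key b hb hbi hβb
  -- the partners are `≥ arccos γ` apart but both in `[c i₁ + arccos γ, c i₁ + arccos β]`
  have hd : Real.arccos γ ≤ |c b - c a| := by
    by_contra! hlt
    have h := Real.cos_lt_cos_of_nonneg_of_le_pi (abs_nonneg _) (Real.arccos_le_pi γ) hlt
    rw [hφ₂, Real.cos_abs, hcosd a ha b hb] at h
    linarith [hsep a ha b hb hab]
  have hd2 : |c b - c a| ≤ Real.arccos β - Real.arccos γ := by
    rw [abs_le]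
    constructor <;> linarith
  have h2 : 2 * Real.arccos γ ≤ Real.arccos β := by linarith
  have h := Real.cos_le_cos_of_nonneg_of_le_pi (by linarith [Real.arccos_nonneg γ])
    (Real.arccos_le_pi β) h2
  rw [hφ₁, Real.cos_two_mul, hφ₂] at h
  linarith

/-! ## Planar lemma 2: a direction near a ring site, far from both its partners, is very near -/

/-- Scalar core of the partner-side lemma: unit `(m, n)` with `m ≥ 0.766`, unit `(P, Q)` with
`P ∈ [0.23, 0.46]`, `Q n ≤ 0` and `P m - Q n ≤ 0.401` force `m ≥ 0.967`
(`|Q| ≥ 0.8879`, `|Q| |n| ≤ 0.401 - 0.23·0.766`, so `|n| ≤ 0.2533`). [folklore] -/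
theorem partner_side_core {m n P Q : ℝ} (h1 : m ^ 2 + n ^ 2 = 1) (hm : 0.766 ≤ m)
    (h2 : P ^ 2 + Q ^ 2 = 1) (hP1 : 0.23 ≤ P) (hP2 : P ≤ 0.46) (hQn : Q * n ≤ 0)
    (hre : P * m - Q * n ≤ 0.401) : 0.967 ≤ m := by
  have hQ2 : 0.7884 ≤ Q ^ 2 := by nlinarith
  have hprod : -(Q * n) ≤ 0.22482 := by nlinarith
  have hsq : (Q * n) ^ 2 ≤ 0.22482 ^ 2 := by nlinarith
  have hn2 : n ^ 2 ≤ 0.0642 := by nlinarith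
  nlinarith

/-- **Partner-side lemma** (numeric instance).  Unit complex numbers `ws, wa, wb` with
`Re ws ≥ 0.766`, `Re (wa conj ws), Re (wb conj ws) ∈ [0.23, 0.46]`, `Re (wa conj wb) ≤ 0.46`
and `Re wa, Re wb ≤ 0.401` force `Re ws ≥ 0.967`: relative to `ws` the two partners lie on
opposite sides (same side would give `Re (wa conj wb) ≥ 0.23² + (1 - 0.46²) > 0.46`), so one of
them lies on the side of `1`, at most `arccos 0.23` beyond `ws`, and its real part `≤ 0.401`
pins `ws` near `1` (`partner_side_core`). [folklore] -/
theorem re_ge_of_two_far_partners {ws wa wb : ℂ} (hs : ‖ws‖ = 1) (ha : ‖wa‖ = 1) (hb : ‖wb‖ = 1)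
    (hms : 0.766 ≤ ws.re)
    (ha1 : 0.23 ≤ (wa * conj ws).re) (ha2 : (wa * conj ws).re ≤ 0.46)
    (hb1 : 0.23 ≤ (wb * conj ws).re) (hb2 : (wb * conj ws).re ≤ 0.46)
    (hab : (wa * conj wb).re ≤ 0.46) (hfa : wa.re ≤ 0.401) (hfb : wb.re ≤ 0.401) :
    0.967 ≤ ws.re := by
  have hunit : ∀ z : ℂ, ‖z‖ = 1 → z.re ^ 2 + z.im ^ 2 = 1 := fun z hz => by
    have h := Complex.sq_norm z
    rw [Complex.normSq_apply, hz, one_pow] at h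
    nlinarith [h]
  have hss : ws * conj ws = 1 := by
    rw [Complex.mul_conj, Complex.normSq_eq_norm_sq, hs]
    norm_num
  have hback : ∀ z : ℂ, z * conj ws * ws = z := fun z => by
    rw [mul_assoc, mul_comm (conj ws) ws, hss, mul_one]
  have hpa : ‖wa * conj ws‖ = 1 := by rw [norm_mul, Complex.norm_conj, ha, hs, one_mul]
  have hpb : ‖wb * conj ws‖ = 1 := by rw [norm_mul, Complex.norm_conj, hb, hs, one_mul]
  have hrot : (wa * conj ws * conj (wb * conj ws)).re = (wa * conj wb).re := re_rot_mul_conj_rot hss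
  -- real parts of `wa`, `wb` in terms of the relative positions
  have hrea : wa.re = (wa * conj ws).re * ws.re - (wa * conj ws).im * ws.im := by
    conv_lhs => rw [← hback wa]
    rw [Complex.mul_re]
  have hreb : wb.re = (wb * conj ws).re * ws.re - (wb * conj ws).im * ws.im := by
    conv_lhs => rw [← hback wb]
    rw [Complex.mul_re]
  have hua := hunit _ hpa
  have hub := hunit _ hpb
  have hus := hunit _ hs
  -- opposite sides
  have hopp : (wa * conj ws).im * (wb * conj ws).im < 0 := by
    by_contra! hge
    have h := hab
    rw [← hrot, re_mul_conj] at h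
    have hqa : 0.7884 ≤ (wa * conj ws).im ^ 2 := by nlinarith
    have hqb : 0.7884 ≤ (wb * conj ws).im ^ 2 := by nlinarith
    have hsq : 0.7884 ^ 2 ≤ ((wa * conj ws).im * (wb * conj ws).im) ^ 2 := by
      rw [mul_pow]
      exact le_trans (by norm_num) (mul_le_mul hqa hqb (by norm_num) (by positivity))
    nlinarith
  -- one of the partners lies on the side of `1`
  rcases le_or_gt ((wa * conj ws).im * ws.im) 0 with hle | hgt
  · exact partner_side_core hus hms hua ha1 ha2 hle (by linarith [hrea])
  · have hle : (wb * conj ws).im * ws.im ≤ 0 := by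
      by_contra! hpos
      have : 0 < ((wa * conj ws).im * (wb * conj ws).im) * ws.im ^ 2 := by nlinarith
      nlinarith [sq_nonneg ws.im]
    exact partner_side_core hus hms hub hb1 hb2 hle (by linarith [hreb])

/-- Registered anchor of this file (worker, stub `fiveFoldFarDisjoint`): the scalar core of the
partner-side lemma (`partner_side_core`) with explicit binders. [folklore] -/
theorem fiveFoldFarDisjoint_partnerSideCore :
    ∀ (m n P Q : ℝ), m ^ 2 + n ^ 2 = 1 → 0.766 ≤ m → P ^ 2 + Q ^ 2 = 1 → 0.23 ≤ P → P ≤ 0.46 →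
      Q * n ≤ 0 → P * m - Q * n ≤ 0.401 → 0.967 ≤ m :=
  fun _ _ _ _ h1 hm h2 hP1 hP2 hQn hre => partner_side_core h1 hm h2 hP1 hP2 hQn hre

end Summit.AtomisticToContinuum.Crystallization.Theorems.SquareWellLayerCakeGapTwelveToBarlow

end
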